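import Summits.NavierStokesRegularity.FluidComputer.RowPhaseStep
import Mathlib.Topology.MetricSpace.Lipschitz
import Mathlib.Analysis.Normed.Group.Bounded
import HarnessLib

/-!
# The row model, part 6: THE PHASE MAP EXISTS ALONG THE WHOLE ROW (layer A′ global, per row;
# `pub-fluidc-bp3/R1-DESIGN.md` §11.7 (G-d)/(G-e-row))

HONEST FRAMING (cell `pub-fluidc`, blueprint seat bp3, gen 22): low prior, high value-of-information
experiment on Tao's machine paradigm; NOT a claim that NS blows up.

WHAT. `row_sound` ASSUMES a member record `MemberOn T₁`, whose phase-dependent half (a continuous,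
right-differentiable phase map `s : [T₀, T₁] → D` locking `y_p(s t) = x̂_p(t)`) is not a hypothesis on
the member but something to be CONSTRUCTED. `phase_global` constructs it: given the certified tables
(`Cert`) and the phase-INDEPENDENT hypotheses `PhaseHyp σ₀` — `D` open; the ODE with defect on `D`;
`σ ↦ F_p(y σ) + δF_p σ` continuous on `D`; the defect class in TUBE form; the maximal-domain property
"`D` contains the closure of any subset on which `y` is bounded" (layer R: blow-up alternative of the
maximal solution); an initial lock `y_p(σ₀) = x̂_p(T₀)`, `σ₀ ∈ D`; and the carried start box written at
`σ₀` — there is a pair `(s, ṡ)` with `s T₀ = σ₀` making `R.withPhase s ṡ` a member on the whole row.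
PROOF (bootstrap on the extent): the set of reachable extents contains `T₀` (constant map), is closed
under restriction, OPEN to the right by `phase_step`, and contains its supremum `τ*`: members on nested
extents agree (`Reparam.phase_unique` on `U = D ∩ {F_p∘y + δF_p ≠ 0}`, where every reached phase lies by
`Fy_p_ne_zero`), the diagonal union is `(1+ρ)`-Lipschitz (`abs_s_sub_le`) hence extends (McShane,
`LipschitzOnWith.extend_real`) continuously to `τ*`, the limit phase lies in `D` by the maximal-domain
property (the member is in the tube, the reference is bounded on the compact row), and the lock passes
to the limit. `withPhase` / `Cert.withPhase`: the tables do not mention the phase map.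

[cite: Tao2016AveragedNS, §5.5 Thm 5.3 (5.5)]
-/

noncomputable section

namespace Summit.NavierStokesRegularity.FluidComputer

namespace RowModel

open Set Real Filter Topology Matrix

variable {ι : Type*} {κ : Type*} [Fintype ι] [Fintype κ] (R : RowModel ι κ) [DecidableEq κ] [DecidableEq ι]

omit [Fintype ι] [Fintype κ] [DecidableEq κ] [DecidableEq ι] in
/-- The same row model with another phase pair `(s, ṡ)`. [folklore] -/
def withPhase (s sd : ℝ → ℝ) : RowModel ι κ := { R with s := s, sd := sd }

/-- **The phase-independent hypotheses of the construction** (layer R's interface for one row; a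
proof-carrying `Type`-valued record like `Cert`): `D` open, the ODE with defect on `D`, continuity of
`F_p∘y + δF_p` on `D`, the defect class in tube form, the maximal-domain property, the initial lock at
`σ₀ ∈ D`, and the carried start box written at `σ₀`. Nothing is asserted. [folklore] -/
structure PhaseHyp (σ₀ : ℝ) : Type where
  /-- the domain is open -/
  hDo : IsOpen R.D
  /-- the ODE with defect -/
  hy : ∀ σ ∈ R.D, ∀ a, HasDerivAt (fun r => R.y r a) (R.F (R.y σ) a + R.δF σ a) σ
  /-- continuity of the phase speed -/
  hFc : ContinuousOn (fun σ => R.F (R.y σ) R.p + R.δF σ R.p) R.D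
  /-- the defect class, tube form -/
  htube : ∀ σ ∈ R.D, ∀ t ∈ Icc R.T₀ R.T₁, (∀ a, |R.y σ a - R.xh t a| ≤ R.Ebar a) →
    ∀ a, |R.δF σ a| ≤ R.δ a
  /-- maximal domain: no exit while bounded -/
  hDmax : ∀ K ⊆ R.D, (∀ a, ∃ C, ∀ σ ∈ K, |R.y σ a| ≤ C) → closure K ⊆ R.D
  /-- initial phase -/
  hσ₀ : σ₀ ∈ R.D
  /-- initial lock -/
  hlock0 : R.y σ₀ R.p = R.xh R.T₀ R.p
  /-- carried start box -/
  hu : ∀ i, |(R.Am R.T₀ *ᵥ fun a => R.y σ₀ a - R.xh R.T₀ a) i| ≤ R.ub 0 i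

variable {R}

/-- The certified tables do not mention the phase map. [folklore] -/
def Cert.withPhase (hc : R.Cert) (s sd : ℝ → ℝ) : (R.withPhase s sd).Cert where
  hh := hc.hh
  hnb := hc.hnb
  hc := hc.hc
  hρ0 := hc.hρ0
  hxh := hc.hxh
  hA := hc.hA
  hF := hc.hF
  hQ := hc.hQ
  hrec := hc.hrec
  hΦ := hc.hΦ
  hDB := hc.hDB
  hJp := hc.hJp
  hGm := hc.hGm
  hRm := hc.hRm
  hKB := hc.hKB
  hCF := hc.hCF
  hAPm := hc.hAPm
  hDp := hc.hDp
  hρ := hc.hρ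
  hφ := hc.hφ
  hB0 := hc.hB0
  hφ0 := hc.hφ0
  hEbar0 := hc.hEbar0
  hE0 := hc.hE0
  hIE := hc.hIE
  hη := hc.hη
  hη' := hc.hη'
  hAd0 := hc.hAd0
  hbd0 := hc.hbd0
  hAdsq := hc.hAdsq
  hbdsq := hc.hbdsq
  hAn0 := hc.hAn0
  hbn0 := hc.hbn0
  hAnsq := hc.hAnsq
  hbnsq := hc.hbnsq
  hAnI := hc.hAnI
  hbnn := hc.hbnn
  hub := hc.hub
  hsup := hc.hsup
  hEbar := hc.hEbar

omit [Fintype ι] [Fintype κ] [DecidableEq κ] [DecidableEq ι] in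
/-- Restriction of a member record to a shorter extent. [folklore] -/
def MemberOn.mono {Ts T : ℝ} (hm : R.MemberOn Ts) (hT : T ≤ Ts) : R.MemberOn T where
  hy := hm.hy
  hsc := hm.hsc.mono (Icc_subset_Icc_right hT)
  hsd := fun t ht => hm.hsd t ⟨ht.1, lt_of_lt_of_le ht.2 hT⟩
  hsD := fun t ht => hm.hsD t ⟨ht.1, ht.2.trans hT⟩
  hlock := fun t ht => hm.hlock t ⟨ht.1, ht.2.trans hT⟩
  hδ := fun t ht => hm.hδ t ⟨ht.1, ht.2.trans hT⟩

/-- The constant phase map is a member on the degenerate extent `[T₀, T₀]`. [folklore] -/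
def memberOn_const (hc : R.Cert) {σ₀ : ℝ} (H : R.PhaseHyp σ₀) :
    (R.withPhase (fun _ => σ₀) (fun _ => 0)).MemberOn R.T₀ where
  hy := H.hy
  hsc := continuousOn_const
  hsd := fun t ht => absurd ht.2 (not_lt.mpr ht.1)
  hsD := fun _ _ => H.hσ₀
  hlock := fun t ht => by
    have h : t = R.T₀ := le_antisymm ht.2 ht.1
    show R.y σ₀ R.p = R.xh t R.p
    rw [h]; exact H.hlock0
  hδ := fun t ht hE a => H.htube σ₀ H.hσ₀ t ⟨ht.1, ht.2.trans (T₀_le_T₁ hc)⟩ hE a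

omit [Fintype ι] [DecidableEq κ] [DecidableEq ι] in
/-- The carried start box of `R.withPhase s ṡ` when `s T₀ = σ₀`. [folklore] -/
theorem hu_withPhase {σ₀ : ℝ} (H : R.PhaseHyp σ₀) {s sd : ℝ → ℝ} (hs0 : s R.T₀ = σ₀) :
    ∀ i, |(R.withPhase s sd).z R.T₀ i| ≤ R.ub 0 i := by
  intro i
  have h := H.hu i
  subst hs0
  exact h

/-- **Members on nested extents agree** (`Reparam.phase_unique` on `U = D ∩ {F_p∘y + δF_p ≠ 0}`).
[folklore] -/
theorem phase_consistent (hc : R.Cert) {σ₀ : ℝ} (H : R.PhaseHyp σ₀) {τ₁ τ₂ : ℝ} (h12 : τ₁ ≤ τ₂)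
    (h0 : R.T₀ ≤ τ₁) (h2 : τ₂ ≤ R.T₁) {s₁ sd₁ s₂ sd₂ : ℝ → ℝ} (hs₁ : s₁ R.T₀ = σ₀)
    (m₁ : (R.withPhase s₁ sd₁).MemberOn τ₁) (hs₂ : s₂ R.T₀ = σ₀)
    (m₂ : (R.withPhase s₂ sd₂).MemberOn τ₂) : ∀ t ∈ Icc R.T₀ τ₁, s₁ t = s₂ t := by
  have hU : IsOpen (R.D ∩ (fun σ => R.F (R.y σ) R.p + R.δF σ R.p) ⁻¹' ({0} : Set ℝ)ᶜ) :=
    H.hFc.isOpen_inter_preimage H.hDo isOpen_compl_singleton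
  have h1c : ContinuousOn s₁ (Icc R.T₀ τ₁) := m₁.hsc
  have h2c : ContinuousOn s₂ (Icc R.T₀ τ₂) := m₂.hsc
  refine Reparam.phase_unique (ψ := fun σ => R.y σ R.p)
    (ψ' := fun σ => R.F (R.y σ) R.p + R.δF σ R.p) (s₁ := s₁) (s₂ := s₂) (T₀ := R.T₀) (τ := τ₁)
    hU (fun σ hσ => H.hy σ hσ.1 R.p) (fun σ hσ h0 => hσ.2 h0) h1c
    (h2c.mono (Icc_subset_Icc_right h12)) ?_ ?_ (by rw [hs₁, hs₂])
  · intro t ht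
    refine ⟨m₁.hsD t ht, ?_⟩
    have h := Fy_p_ne_zero (hc.withPhase s₁ sd₁) m₁ h0 (h12.trans h2) (hu_withPhase H hs₁) ht
    exact h
  · intro t ht
    have e1 : R.y (s₁ t) R.p = R.xh t R.p := m₁.hlock t ht
    have e2 : R.y (s₂ t) R.p = R.xh t R.p := m₂.hlock t ⟨ht.1, ht.2.trans h12⟩
    show R.y (s₁ t) R.p = R.y (s₂ t) R.p
    rw [e1, e2]

/-- **The closedness step of the bootstrap**: if every extent `τ ∈ [T₀, τ*)`, `T₀ < τ* ≤ T₁`, is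
reached by some member starting at `σ₀`, then so is `τ*` (diagonal union, Lipschitz extension, limit
phase in `D` by the maximal-domain property, lock by continuity). [folklore] -/
theorem phase_closed (hc : R.Cert) {σ₀ : ℝ} (H : R.PhaseHyp σ₀) {τs : ℝ} (hτ0 : R.T₀ < τs)
    (hτ1 : τs ≤ R.T₁)
    (hA : ∀ τ ∈ Ico R.T₀ τs, ∃ s sd : ℝ → ℝ, s R.T₀ = σ₀ ∧ Nonempty ((R.withPhase s sd).MemberOn τ)) :
    ∃ s sd : ℝ → ℝ, s R.T₀ = σ₀ ∧ Nonempty ((R.withPhase s sd).MemberOn τs) := by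
  choose! sτ sdτ hs0 hmem using hA
  -- the start boxes and the per-extent facts
  have hu : ∀ τ ∈ Ico R.T₀ τs, ∀ i, |(R.withPhase (sτ τ) (sdτ τ)).z R.T₀ i| ≤ R.ub 0 i :=
    fun τ hτ => hu_withPhase H (hs0 τ hτ)
  have hcons : ∀ τ ∈ Ico R.T₀ τs, ∀ τ' ∈ Ico R.T₀ τs, τ ≤ τ' →
      ∀ t ∈ Icc R.T₀ τ, sτ τ t = sτ τ' t := fun τ hτ τ' hτ' hle =>
    phase_consistent hc H hle hτ.1 (hτ'.2.le.trans hτ1) (hs0 τ hτ) (hmem τ hτ).some (hs0 τ' hτ')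
      (hmem τ' hτ').some
  -- the diagonal extent `τ⁺ t := (t + τ*) / 2`
  have hτp : ∀ t ∈ Ico R.T₀ τs, (t + τs) / 2 ∈ Ico R.T₀ τs ∧ t < (t + τs) / 2 := fun t ht =>
    ⟨⟨by linarith [ht.1, ht.2], by linarith [ht.2]⟩, by linarith [ht.2]⟩
  set sstar : ℝ → ℝ := fun t => sτ ((t + τs) / 2) t with hsstar
  have hstar : ∀ τ ∈ Ico R.T₀ τs, ∀ t ∈ Icc R.T₀ τ, sstar t = sτ τ t := by
    intro τ hτ t ht
    obtain ⟨htp, hlt⟩ := hτp t ⟨ht.1, lt_of_le_of_lt ht.2 hτ.2⟩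
    rcases le_total ((t + τs) / 2) τ with h | h
    · exact hcons _ htp τ hτ h t ⟨ht.1, hlt.le⟩
    · exact (hcons τ hτ _ htp h t ht).symm
  -- the tube on the reached part, hence `y ∘ s*` bounded
  have htubeE : ∀ t ∈ Ico R.T₀ τs, ∀ a, |R.y (sstar t) a - R.xh t a| ≤ R.Ebar a := by
    intro t ht a
    obtain ⟨htp, hlt⟩ := hτp t ht
    rw [hstar _ htp t ⟨ht.1, hlt.le⟩]
    have h := (row_sound_on (hc.withPhase _ _) (hmem _ htp).some htp.1 (htp.2.le.trans hτ1)
      (hu _ htp)).1 t ⟨ht.1, hlt.le⟩ a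
    exact h
  -- Lipschitz on `[T₀, τ*)`
  have hlip : ∀ t ∈ Ico R.T₀ τs, ∀ t' ∈ Ico R.T₀ τs, t ≤ t' →
      |sstar t' - sstar t| ≤ (1 + R.ρ) * (t' - t) := by
    intro t ht t' ht' hle
    obtain ⟨hτ₁, hlt⟩ := hτp t' ht'
    rw [hstar _ hτ₁ t' ⟨ht'.1, hlt.le⟩, hstar _ hτ₁ t ⟨ht.1, hle.trans hlt.le⟩]
    exact abs_s_sub_le (hc.withPhase _ _) (hmem _ hτ₁).some hτ₁.1 (hτ₁.2.le.trans hτ1) (hu _ hτ₁)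
      ⟨ht.1, hle.trans hlt.le⟩ ⟨ht'.1, hlt.le⟩ hle
  have hK0 : 0 ≤ 1 + R.ρ := by linarith [hc.hρ0]
  have hK : LipschitzOnWith (Real.toNNReal (1 + R.ρ)) sstar (Ico R.T₀ τs) := by
    refine LipschitzOnWith.of_dist_le_mul fun t ht t' ht' => ?_
    rw [Real.dist_eq, Real.dist_eq, Real.coe_toNNReal _ hK0]
    rcases le_total t t' with h | h
    · rw [abs_sub_comm (sstar t), abs_sub_comm t, abs_of_nonneg (sub_nonneg.mpr h)]
      exact hlip t ht t' ht' h
    · rw [abs_of_nonneg (sub_nonneg.mpr h)]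
      exact hlip t' ht' t ht h
  obtain ⟨g, hg, hEq⟩ := hK.extend_real
  have hgc : Continuous g := hg.continuous
  have hT0I : R.T₀ ∈ Ico R.T₀ τs := ⟨le_rfl, hτ0⟩
  -- `g = s_τ` on `[T₀, τ]` for every reached `τ`
  have hgτ : ∀ τ ∈ Ico R.T₀ τs, ∀ t ∈ Icc R.T₀ τ, g t = sτ τ t := fun τ hτ t ht => by
    rw [← hEq ⟨ht.1, lt_of_le_of_lt ht.2 hτ.2⟩]; exact hstar τ hτ t ht
  -- the limit phase lies in `D`
  have hKD : sstar '' Ico R.T₀ τs ⊆ R.D := by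
    rintro σ ⟨t, ht, rfl⟩
    obtain ⟨htp, hlt⟩ := hτp t ht
    rw [hstar _ htp t ⟨ht.1, hlt.le⟩]
    exact (hmem _ htp).some.hsD t ⟨ht.1, hlt.le⟩
  have hbd : ∀ a, ∃ C, ∀ σ ∈ sstar '' Ico R.T₀ τs, |R.y σ a| ≤ C := by
    intro a
    have hxc : ContinuousOn (fun t => R.xh t a) (Icc R.T₀ R.T₁) :=
      fun t _ => (hc.hxh t a).continuousAt.continuousWithinAt
    obtain ⟨C, hC⟩ := isCompact_Icc.exists_bound_of_continuousOn hxc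
    refine ⟨C + R.Ebar a, ?_⟩
    rintro σ ⟨t, ht, rfl⟩
    have h1 := htubeE t ht a
    have h2 := hC t ⟨ht.1, ht.2.le.trans hτ1⟩
    rw [Real.norm_eq_abs] at h2
    have h3 := abs_sub_abs_le_abs_sub (R.y (sstar t) a) (R.xh t a)
    linarith
  have hcl : closure (sstar '' Ico R.T₀ τs) ⊆ R.D := H.hDmax _ hKD hbd
  have hgT : Tendsto g (𝓝[<] τs) (𝓝 (g τs)) := (hgc.tendsto τs).mono_left nhdsWithin_le_nhds
  have hgτs : g τs ∈ R.D := by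
    refine hcl (mem_closure_of_tendsto hgT ?_)
    filter_upwards [Ico_mem_nhdsLT hτ0] with t ht
    rw [← hEq ht]; exact mem_image_of_mem _ ht
  have hgD : ∀ t ∈ Icc R.T₀ τs, g t ∈ R.D := by
    intro t ht
    rcases eq_or_lt_of_le ht.2 with h | h
    · rw [h]; exact hgτs
    · rw [← hEq ⟨ht.1, h⟩]; exact hKD (mem_image_of_mem _ ⟨ht.1, h⟩)
  -- the lock passes to the limit
  have hglock : ∀ t ∈ Icc R.T₀ τs, R.y (g t) R.p = R.xh t R.p := by
    have hlt : ∀ t ∈ Ico R.T₀ τs, R.y (g t) R.p = R.xh t R.p := by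
      intro t ht
      obtain ⟨htp, hlt⟩ := hτp t ht
      rw [hgτ _ htp t ⟨ht.1, hlt.le⟩]
      exact (hmem _ htp).some.hlock t ⟨ht.1, hlt.le⟩
    intro t ht
    rcases eq_or_lt_of_le ht.2 with h | h
    · rw [h]
      have hcont : ContinuousAt (fun t => R.y (g t) R.p - R.xh t R.p) τs :=
        (((H.hy (g τs) hgτs R.p).continuousAt).comp hgc.continuousAt).sub
          (hc.hxh τs R.p).continuousAt
      have hlim : Tendsto (fun t => R.y (g t) R.p - R.xh t R.p) (𝓝[<] τs) (𝓝 0) := by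
        refine (tendsto_const_nhds (x := (0:ℝ))).congr' ?_
        filter_upwards [Ico_mem_nhdsLT hτ0] with t ht
        rw [hlt t ht, sub_self]
      have hcT : Tendsto (fun t => R.y (g t) R.p - R.xh t R.p) (𝓝[<] τs)
          (𝓝 (R.y (g τs) R.p - R.xh τs R.p)) := hcont.tendsto.mono_left nhdsWithin_le_nhds
      have h0 := tendsto_nhds_unique hcT hlim
      linarith
    · exact hlt t ⟨ht.1, h⟩
  -- the member on `[T₀, τ*]`
  refine ⟨g, fun t => sdτ ((t + τs) / 2) t, by rw [← hEq hT0I]; exact hs0 _ (hτp _ hT0I).1, ⟨?_⟩⟩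
  refine memberOn_of_tube (R := R.withPhase g fun t => sdτ ((t + τs) / 2) t) hτ1 H.hy H.htube
    hgc.continuousOn ?_ hgD hglock
  intro t ht
  obtain ⟨htp, hlt⟩ := hτp t ht
  have h : HasDerivWithinAt (sτ ((t + τs) / 2)) (sdτ ((t + τs) / 2) t) (Ici t) t :=
    (hmem _ htp).some.hsd t ⟨ht.1, hlt⟩
  refine h.congr_of_eventuallyEq ?_ (hgτ _ htp t ⟨ht.1, hlt.le⟩)
  filter_upwards [inter_mem_nhdsWithin (Ici t) (Iio_mem_nhds hlt)] with r hr
  exact hgτ _ htp r ⟨ht.1.trans hr.1, le_of_lt hr.2⟩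

/-- **Layer A′, per row: the phase map exists along the whole row.** Under the certified tables and the
phase-independent hypotheses `PhaseHyp σ₀` there is a pair `(s, ṡ)` with `s T₀ = σ₀` for which
`R.withPhase s ṡ` satisfies the member hypotheses `MemberOn T₁` of `row_sound`. [folklore] -/
theorem phase_global (hc : R.Cert) {σ₀ : ℝ} (H : R.PhaseHyp σ₀) :
    ∃ s sd : ℝ → ℝ, s R.T₀ = σ₀ ∧ Nonempty ((R.withPhase s sd).MemberOn R.T₁) := by
  set A : Set ℝ := {τ | ∃ s sd : ℝ → ℝ, s R.T₀ = σ₀ ∧ Nonempty ((R.withPhase s sd).MemberOn τ)}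
    with hAdef
  have hT01 : R.T₀ ≤ R.T₁ := T₀_le_T₁ hc
  have h0A : R.T₀ ∈ A := ⟨fun _ => σ₀, fun _ => 0, rfl, ⟨memberOn_const hc H⟩⟩
  have hmono : ∀ τ ∈ A, ∀ τ' ≤ τ, τ' ∈ A := fun τ ⟨s, sd, hs, ⟨m⟩⟩ τ' hle =>
    ⟨s, sd, hs, ⟨m.mono hle⟩⟩
  set S : Set ℝ := A ∩ Icc R.T₀ R.T₁ with hSdef
  have h0S : R.T₀ ∈ S := ⟨h0A, left_mem_Icc.mpr hT01⟩
  have hne : S.Nonempty := ⟨_, h0S⟩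
  have hbdd : BddAbove S := ⟨R.T₁, fun τ hτ => hτ.2.2⟩
  have hτs1 : sSup S ≤ R.T₁ := csSup_le hne fun τ hτ => hτ.2.2
  have hτs0 : R.T₀ ≤ sSup S := le_csSup hbdd h0S
  have hbelow : ∀ τ ∈ Ico R.T₀ (sSup S), τ ∈ A := fun τ hτ => by
    obtain ⟨τ', hτ'S, hlt⟩ := exists_lt_of_lt_csSup hne hτ.2
    exact hmono τ' hτ'S.1 τ hlt.le
  have hτsA : sSup S ∈ A := by
    rcases eq_or_lt_of_le hτs0 with h | h
    · rw [← h]; exact h0A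
    · exact phase_closed hc H h hτs1 hbelow
  rcases eq_or_lt_of_le hτs1 with h | h
  · rw [← h]; exact hτsA
  · exfalso
    obtain ⟨s, sd, hs0, ⟨m⟩⟩ := hτsA
    obtain ⟨T', hT'1, hT'2, s', sd', hagree, -, hsc, hsd, hsD, hlock⟩ :=
      phase_step (hc.withPhase s sd) m hτs0 h (hu_withPhase H hs0) H.hDo H.hFc
    have hs0' : s' R.T₀ = σ₀ := by rw [hagree R.T₀ ⟨le_rfl, hτs0⟩]; exact hs0
    have hT'A : T' ∈ A :=
      ⟨s', sd', hs0', ⟨memberOn_of_tube (R := R.withPhase s' sd') hT'2 H.hy H.htube hsc hsd hsD hlock⟩⟩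
    have hle : T' ≤ sSup S := le_csSup hbdd ⟨hT'A, hτs0.trans hT'1.le, hT'2⟩
    linarith

end RowModel

end Summit.NavierStokesRegularity.FluidComputer
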